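import Summits.CriticalPhenomena.PercolationContinuityZ3.Theorems.PercNearOneGluingNoHeavyRsw3AnnulusTwoArmFromBlocking
import Summits.CriticalPhenomena.PercolationContinuityZ3.Theorems.PercNonProliferationSubpolynomialBlockingStubBlockerRSWGlue
import Summits.CriticalPhenomena.PercolationContinuityZ3.Theorems.PercAnnulusCrossingBoxCrossingLength
import HarnessLib

/-!
# RSW3 lane (P2, gen 10): DICTIONARY — the route node `X_B` IS Kesten-type blocking of the `(n; 2n, 2n)` block:
# `CritAnnulusNonCrossing ↔ BlockingLowerBound (easyShape 2) 0`; and `easy₂`-blocking ⇒ `CubeBlockingSeed`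

builds on p205010 (kernel theorem, internal audit signed; external expert review pending)

Cell `prim-rsw3`, prover seat `prim-rsw3-p2` (gen 10), memo `run/shared/lean/prim/rsw3/P2-RSWLITE.md` §16.
Support file (`--supports stmt-CriticalPhenomena-4575`); no definitions, no named facts, no sorries.  Companion of
`…Rsw3AnnulusTwoArmSpongeDichotomy` (`BlockingLowerBound (easyShape 2) 0 → AnnulusTwoArmLowerBound`).

STATEMENTS (all at `p_c(ℤ³)` except the first, which holds at every `p`).
* `real_boxCross_easyShape_two_le_real_annulusCrossing`: `P_p(boxCross (easyShape 2 n) 0) ≤ P_p(annulusCrossing 3 n)` — the slab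
  `[n, 2n] × [-n, n]²` is a translate of `{0..n} × {0..2n}²`, its near face lies in `Λ(n)`, its far face on `∂ⁱⁿΛ(2n)`.
* `blockingLowerBound_easyShape_two_of_critAnnulusNonCrossing`: `X_B → BlockingLowerBound (easyShape 2) 0`.
* `critAnnulusNonCrossing_of_blockingLowerBound_easyShape_two`: `BlockingLowerBound (easyShape 2) 0 → X_B`, ASSEMBLED FROM THE
  TREE: the Union-Lemma tiling `w_n^K ≤ V_n` for `n ≥ N` (`SubpolynomialBlocking.StubBlockerRSWGlue.tiling_one`, i.e.
  `stub_tiling` at `k = 1`, crux stmt-CriticalPhenomena-4446), the six-slab bound `V_n^6 ≤ u_n = 1 - P_{p_c}(annulusCrossing 3 n)`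
  (`SubpolynomialBlocking.stub_sixSlab`), positivity at the finitely many small scales
  (`StubBlockerRSWGlue.exists_pos_forall_le_blockProb`); `w_n = P_{p_c}((boxCross (easyShape 2 n) 0)ᶜ)` by
  `StubBlockerRSWGlue.sealEvent_eq`.  (The tree's `stub_blockerRSWGlue` runs the same chain from the stronger pair
  `BlockerRSW3D ∧ CubeBlockingSeed`; here the hypothesis is the lane's typed blocking node itself.)
* `critAnnulusNonCrossing_iff_blockingLowerBound_easyShape_two`: the equivalence.
* `blockingLowerBound_cubeShape_of_easyShape_two`: `easy₂`-blocking ⇒ cube blocking (`= CubeBlockingSeed`, Kesten Comment (v)).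

READING for the lane's LADDER (R2): `X_B ⇔ BlockingLowerBound (easyShape 2) 0 ⇒ BlockingLowerBound cubeShape 0 = CubeBlockingSeed`,
and `BlockerRSW3D` (stmt-1129) is exactly the missing converse "cube-blocking ⇒ easy₂-blocking".  Hence every lane theorem
with hypothesis `X_B` (tight annulus counts p217117, aspect-2 two arms p232691, many spanning clusters in thin slabs p234099)
may equivalently be read with the sponge-blocking hypothesis `∃ c > 0, ∀ n ≥ 1, P_{p_c}({0..n} × {0..2n}² not crossed the thin way) ≥ c`.

HONEST PLACEMENT.  Bookkeeping over landed stubs plus one inclusion; no new mathematics.  Recorded so that the lane's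
verdict table carries ONE R2 node in two vocabularies (annulus / Kesten block) with a kernel pointer.

References: H. Kesten, *Percolation Theory for Mathematicians* (1982), §3.3 Comment (v), (3.65), Thm. 5.1 [Kesten1982];
M. Aizenman, Nucl. Phys. B 485 (1997), §5 [Aizenman1997]; I. Benjamini, G. Kalai (2018), p. 71 [BenjaminiKalai2018];
G. Grimmett, *Percolation* (1999), §1.6, Thm. (2.4) [GrimmettPercolation1999]. [folklore]
-/

noncomputable section

namespace Summit.CriticalPhenomena.PercolationContinuityZ3.Theorems

open MeasureTheory ProbabilityTheory Filter Topology
open Literature.Probability.Percolation Literature.Probability.LatticeModels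
open Literature.Barriers.CriticalPhenomena

namespace Rsw3

open SurfaceTension Crossing

variable {d : ℕ}

/-! ## Dictionary: `X_B ↔ BlockingLowerBound (easyShape 2) 0` -/

/-- **A thin-way crossing of the slab `[n, 2n] × [-n, n]²` crosses the annulus:**
`P_p(boxCross (easyShape 2 n) 0) ≤ P_p(annulusCrossing 3 n)` for every `p` and `n`.  The slab is a translate of
`{0..n} × {0..2n}²`; its near face lies in `Λ(n)`, its far face on `∂ⁱⁿΛ(2n)`, and it sits inside `Λ(2n)`. [folklore] -/
theorem real_boxCross_easyShape_two_le_real_annulusCrossing (p : unitInterval) (n : ℕ) :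
    (bondPercolation (zdGraph 3) p).real (boxCross (easyShape 2 n) 0) ≤
      (bondPercolation (zdGraph 3) p).real (annulusCrossing 3 n) := by
  classical
  set μ := bondPercolation (zdGraph 3) p with hμ
  set blk : Finset (Site 3) := Finset.Icc (0 : Site 3) (easyShape 2 n) with hblk
  set F0 : Set (Site 3) := {x | x ∈ blk ∧ x 0 = 0} with hF0
  set F1 : Set (Site 3) := {x | x ∈ blk ∧ x 0 = easyShape 2 n 0} with hF1
  have hE0 : easyShape 2 n 0 = n := by simp [easyShape]
  have hE : ∀ j : Fin 3, j ≠ 0 → easyShape 2 n j = 2 * n := by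
    intro j hj; fin_cases j <;> simp [easyShape] at hj ⊢
  set v₁ : Site 3 := ![(n : ℤ), -(n : ℤ), -(n : ℤ)] with hv₁
  have hv₁0 : v₁ 0 = n := by simp [hv₁]
  have hv₁j : ∀ j : Fin 3, j ≠ 0 → v₁ j = -(n : ℤ) := by
    intro j hj; fin_cases j <;> simp [hv₁] at hj ⊢
  have hmem_blk : ∀ x : Site 3, x ∈ blk ↔ (0 ≤ x 0 ∧ x 0 ≤ n) ∧ ∀ j : Fin 3, j ≠ 0 → 0 ≤ x j ∧ x j ≤ 2 * n := by
    intro x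
    rw [hblk, Finset.mem_Icc]
    constructor
    · rintro ⟨h0, h1⟩
      refine ⟨⟨by simpa using h0 0, by simpa [hE0] using h1 0⟩, fun j hj => ⟨by simpa using h0 j, ?_⟩⟩
      have := h1 j; rwa [hE j hj] at this
    · rintro ⟨⟨h00, h01⟩, hj⟩
      refine ⟨fun j => ?_, fun j => ?_⟩
      · by_cases h : j = 0
        · subst h; simpa using h00
        · simpa using (hj j h).1
      · by_cases h : j = 0
        · subst h; simpa [hE0] using h01
        · rw [hE j h]; exact (hj j h).2
  -- move to the slab `blk + v₁`
  have hle1 : μ.real (boxCross (easyShape 2 n) 0) ≤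
      μ.real (linked ((zdShiftIso v₁) '' (↑blk : Set (Site 3))) ((zdShiftIso v₁) '' F0) ((zdShiftIso v₁) '' F1)) := by
    rw [hμ, real_linked_image (zdShiftIso v₁) p (↑blk : Set (Site 3)) F0 F1, hF0, hF1, hblk]
    exact real_boxCross_le_real_linked_faces p (easyShape 2 n) 0
  refine hle1.trans (DCT16.real_mono_of_forall_subset_edgeSet (zdGraph 3) p fun ω _ h => ?_)
  rw [mem_linked_iff] at h
  obtain ⟨_, ⟨a₀, ⟨ha₀, ha₀0⟩, rfl⟩, _, ⟨b₀, ⟨hb₀, hb₀0⟩, rfl⟩, hab⟩ := h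
  obtain ⟨⟨-, -⟩, ha₀j⟩ := (hmem_blk a₀).1 ha₀
  obtain ⟨⟨-, -⟩, hb₀j⟩ := (hmem_blk b₀).1 hb₀
  rw [hE0] at hb₀0
  set a : Site 3 := (zdShiftIso v₁) a₀ with ha_def
  set b : Site 3 := (zdShiftIso v₁) b₀ with hb_def
  have ha_apply : ∀ i, a i = a₀ i + v₁ i := fun i => rfl
  have hb_apply : ∀ i, b i = b₀ i + v₁ i := fun i => rfl
  have ha0 : a 0 = n := by rw [ha_apply, ha₀0, hv₁0]; simp
  have hb0 : b 0 = 2 * n := by rw [hb_apply, hb₀0, hv₁0]; ring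
  have ha_box : a ∈ box 3 n := by
    rw [mem_box]; intro i
    by_cases hi : i = 0
    · subst hi; rw [ha0]; omega
    · rw [ha_apply, hv₁j i hi]; have := ha₀j i hi; omega
  have hblk_sub : (zdShiftIso v₁) '' (↑blk : Set (Site 3)) ⊆ (↑(box 3 (2 * n)) : Set (Site 3)) := by
    rintro _ ⟨y, hy, rfl⟩
    rw [Finset.mem_coe] at hy
    obtain ⟨⟨hy00, hy01⟩, hyj⟩ := (hmem_blk y).1 hy
    rw [Finset.mem_coe, mem_box]
    intro i
    rw [zdShiftIso_apply, Pi.add_apply]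
    by_cases hi : i = 0
    · subst hi; rw [hv₁0]; omega
    · rw [hv₁j i hi]; have := hyj i hi; omega
  have hb_box : b ∈ box 3 (2 * n) := Finset.mem_coe.1 (hblk_sub ⟨b₀, Finset.mem_coe.2 hb₀, rfl⟩)
  have hb_bd : b ∈ innerBoundary (zdGraph 3) (box 3 (2 * n)) :=
    DCT16.mem_innerBoundary_box_of_natAbs_eq hb_box (i := 0) (by rw [hb0]; omega)
  have hconn_ab : ω ∈ openConnIn (↑(box 3 (2 * n)) : Set (Site 3)) a b := by
    have h := inConn_mono hblk_sub _ _ hab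
    rw [openConnIn_eq_openConnVia (Finset.mem_coe.2 (box_mono 3 (by omega) ha_box))]
    exact openConnVia_mono_graph (Quant.withinGraph_le_withinGraph_top _) _ _ h
  exact ⟨a, ha_box, b, hb_bd, hconn_ab⟩

/-- **`X_B ⇒ BlockingLowerBound (easyShape 2) 0`** (`c_X ≤ 1 - P(annulusCrossing 3 n) ≤ 1 - σ_{p_c}(easyShape 2 n)`).
builds on p205010 (kernel theorem, internal audit signed; external expert review pending). [folklore] -/
theorem blockingLowerBound_easyShape_two_of_critAnnulusNonCrossing
    (hX : Summit.CriticalPhenomena.PercolationContinuityZ3.Theses.PercAnnulusCrossing.CritAnnulusNonCrossing) :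
    BlockingLowerBound (easyShape 2) 0 := by
  obtain ⟨cX, hcX, hX'⟩ := critAnnulusNonCrossing_iff.1 hX
  refine ⟨cX, hcX, fun n hn => ?_⟩
  rw [probReal_compl_eq_one_sub (measurableSet_boxCross _ _)]
  have h1 := real_boxCross_easyShape_two_le_real_annulusCrossing (criticalProbI 3) n
  have h2 := hX' n hn
  linarith

/-- **`BlockingLowerBound (easyShape 2) 0 ⇒ X_B`**, assembled from the tree: the Union-Lemma tiling
`w_n^K ≤ V_n` for `n ≥ N` (`StubBlockerRSWGlue.tiling_one`, from `stub_tiling` at `k = 1`), the six-slab bound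
`V_n^6 ≤ u_n = 1 - P_{p_c}(annulusCrossing 3 n)` (`stub_sixSlab`), and positivity of `u_n` at the finitely many
small scales (`StubBlockerRSWGlue.exists_pos_forall_le_blockProb`); here `w_n = P_{p_c}((boxCross (easyShape 2 n) 0)ᶜ)`
(`StubBlockerRSWGlue.sealEvent_eq`).
builds on p205010 (kernel theorem, internal audit signed; external expert review pending). [folklore] -/
theorem critAnnulusNonCrossing_of_blockingLowerBound_easyShape_two (hB : BlockingLowerBound (easyShape 2) 0) :
    Summit.CriticalPhenomena.PercolationContinuityZ3.Theses.PercAnnulusCrossing.CritAnnulusNonCrossing := by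
  obtain ⟨cB, hcB, hB'⟩ := hB
  -- `w_n ≥ c_B` in the `Set.Icc`/`openCrossing` spelling
  have hw : ∀ n : ℕ, 1 ≤ n → cB ≤
      (bondPercolation (zdGraph 3) (criticalProbI 3)).real
        (openCrossing (Set.Icc (0 : Site 3) ![(n : ℤ), 2 * n, 2 * n])
          {x | x ∈ Set.Icc (0 : Site 3) ![(n : ℤ), 2 * n, 2 * n] ∧ x 0 = 0}
          {y | y ∈ Set.Icc (0 : Site 3) ![(n : ℤ), 2 * n, 2 * n] ∧ y 0 = (n : ℤ)})ᶜ := by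
    intro n hn
    rw [← SubpolynomialBlocking.StubBlockerRSWGlue.sealEvent_eq]
    have h := hB' n hn
    have hset : (boxCross (easyShape 2 n) 0)ᶜ =
        {ω : BondConfig (Site 3) | ¬ ∃ x ∈ Finset.Icc (0 : Site 3) ![(n : ℤ), 2 * n, 2 * n],
          ∃ y ∈ Finset.Icc (0 : Site 3) ![(n : ℤ), 2 * n, 2 * n],
            x 0 = 0 ∧ y 0 = (n : ℤ) ∧ ω ∈ openConnIn ↑(Finset.Icc (0 : Site 3) ![(n : ℤ), 2 * n, 2 * n]) x y} := by
      ext ω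
      simp only [boxCross, easyShape, Set.mem_compl_iff, Set.mem_setOf_eq, Matrix.cons_val_zero, Nat.cast_ofNat]
    rwa [hset] at h
  -- large scales
  obtain ⟨K, N, hKN⟩ := SubpolynomialBlocking.StubBlockerRSWGlue.tiling_one
  have hlarge : ∀ n : ℕ, 1 ≤ n → N ≤ n → (cB ^ K) ^ 6 ≤
      SubpolynomialBlocking.Negative.blockProb 3 (criticalProbI 3) n := by
    intro n hn hNn
    calc (cB ^ K) ^ 6
        ≤ ((bondPercolation (zdGraph 3) (criticalProbI 3)).real
            (openCrossing (Set.Icc (0 : Site 3) ![(n : ℤ), 2 * n, 2 * n])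
              {x | x ∈ Set.Icc (0 : Site 3) ![(n : ℤ), 2 * n, 2 * n] ∧ x 0 = 0}
              {y | y ∈ Set.Icc (0 : Site 3) ![(n : ℤ), 2 * n, 2 * n] ∧ y 0 = (n : ℤ)})ᶜ ^ K) ^ 6 :=
          pow_le_pow_left₀ (pow_nonneg hcB.le K) (pow_le_pow_left₀ hcB.le (hw n hn) K) 6
      _ ≤ (bondPercolation (zdGraph 3) (criticalProbI 3)).real
            (openCrossing (Set.Icc (![(n : ℤ), -(2 * (n : ℤ)), -(2 * (n : ℤ))] : Site 3)
                ![2 * (n : ℤ), 2 * (n : ℤ), 2 * (n : ℤ)])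
              {x | x ∈ Set.Icc (![(n : ℤ), -(2 * (n : ℤ)), -(2 * (n : ℤ))] : Site 3)
                ![2 * (n : ℤ), 2 * (n : ℤ), 2 * (n : ℤ)] ∧ x 0 = (n : ℤ)}
              {y | y ∈ Set.Icc (![(n : ℤ), -(2 * (n : ℤ)), -(2 * (n : ℤ))] : Site 3)
                ![2 * (n : ℤ), 2 * (n : ℤ), 2 * (n : ℤ)] ∧ y 0 = 2 * (n : ℤ)})ᶜ ^ 6 :=
          pow_le_pow_left₀ (pow_nonneg measureReal_nonneg K) (hKN n hNn) 6
      _ ≤ SubpolynomialBlocking.Negative.blockProb 3 (criticalProbI 3) n :=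
          SubpolynomialBlocking.stub_sixSlab n hn
  -- small scales
  obtain ⟨c₁, hc₁, hsmall⟩ := SubpolynomialBlocking.StubBlockerRSWGlue.exists_pos_forall_le_blockProb N
  refine critAnnulusNonCrossing_iff.2 ⟨min ((cB ^ K) ^ 6) c₁, lt_min (by positivity) hc₁, fun n hn => ?_⟩
  have hu : min ((cB ^ K) ^ 6) c₁ ≤ SubpolynomialBlocking.Negative.blockProb 3 (criticalProbI 3) n := by
    rcases Nat.lt_or_ge n N with hNn | hNn
    · exact (min_le_right _ _).trans (hsmall n hn hNn.le)
    · exact (min_le_left _ _).trans (hlarge n hn hNn)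
  rw [SubpolynomialBlocking.Negative.blockProb_eq] at hu
  linarith

/-- **DICTIONARY: `X_B ↔ BlockingLowerBound (easyShape 2) 0`.**  The route node `CritAnnulusNonCrossing` (aspect-2 annulus
blocking at `p_c(ℤ³)`, stmt-CriticalPhenomena-0846) is equivalent to Kesten-type blocking of the `(n; 2n, 2n)` block:
in the lane's LADDER, `X_B ⇔ easy₂-blocking ⇒ CubeBlockingSeed` (`blockingLowerBound_cubeShape_of_easyShape_two`) and
`BlockerRSW3D` is precisely "cube-blocking ⇒ easy₂-blocking".
builds on p205010 (kernel theorem, internal audit signed; external expert review pending). [folklore] -/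
theorem critAnnulusNonCrossing_iff_blockingLowerBound_easyShape_two :
    Summit.CriticalPhenomena.PercolationContinuityZ3.Theses.PercAnnulusCrossing.CritAnnulusNonCrossing ↔
      BlockingLowerBound (easyShape 2) 0 :=
  ⟨blockingLowerBound_easyShape_two_of_critAnnulusNonCrossing, critAnnulusNonCrossing_of_blockingLowerBound_easyShape_two⟩

/-- **easy₂-blocking ⇒ cube blocking** (`BlockingLowerBound (easyShape 2) 0 → BlockingLowerBound cubeShape 0`, i.e.
`→ CubeBlockingSeed`): a `0`-crossing of the cube `{0..n}³` is a `0`-crossing of the wider block `{0..n} × {0..2n}²`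
(Kesten's Comment 3.3 (v), `real_boxCross_anti`), so blocking the wide block blocks the cube. [cite: Kesten1982, §3.3 Comment (v)] -/
theorem blockingLowerBound_cubeShape_of_easyShape_two (hB : BlockingLowerBound (easyShape 2) 0) :
    BlockingLowerBound cubeShape 0 := by
  obtain ⟨cB, hcB, hB'⟩ := hB
  refine ⟨cB, hcB, fun n hn => (hB' n hn).trans ?_⟩
  rw [probReal_compl_eq_one_sub (measurableSet_boxCross _ _), probReal_compl_eq_one_sub (measurableSet_boxCross _ _)]
  have h : (bondPercolation (zdGraph 3) (criticalProbI 3)).real (boxCross (cubeShape n) 0) ≤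
      (bondPercolation (zdGraph 3) (criticalProbI 3)).real (boxCross (easyShape 2 n) 0) := by
    refine real_boxCross_anti (criticalProbI 3) (L := easyShape 2 n) (L' := cubeShape n) (i := 0) ?_ ?_ ?_
    · simp [easyShape]
    · simp [cubeShape, easyShape]
    · intro j hj; fin_cases j <;> simp [cubeShape, easyShape] at hj ⊢ <;> omega
  linarith

end Rsw3

end Summit.CriticalPhenomena.PercolationContinuityZ3.Theorems

end
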